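import Literature.AnabelianGeometry.SemiGraphs.CovObjOrbitCosetGraph
import Literature.AnabelianGeometry.SemiGraphs.SubgroupPresentationMapTo
import Literature.AnabelianGeometry.SemiGraphs.TemperedPiPresentation
import HarnessLib

/-!
# Point presentations are natural in the covering ([SemiAnbd] Rmk 2.2.1 p. 24, §3 p. 38 / p. 41)

Mochizuki, *Semi-graphs of anabelioids*, Publ. RIMS **42** (2006), Rmk. 2.2.1 p. 24 (the images of
`Π_v`, `Π_b` in the Galois group of a covering are natural in the covering), Prop. 3.6 p. 38
("`Gal(𝒢_{∞,j}/𝒢) → Gal(𝒢_{∞,i}/𝒢)`", "`Gal(𝒢_{∞,i}/𝒢) → Gal(𝒢_i/𝒢)`") and §3 proof of Thm. 3.7 (iii)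
p. 41 (the "natural maps `V_i → V_j`, `E_i → E_j`" between the semi-graphs of the levels)
[cite: MochizukiSemiAnbd2006, Prop 3.6 p.38].

DICTIONARY, part 3 (cell row T54-B, tower third, file T3e-1; plan/GAP-LEDGER.md G-w4d053-1).  For a
morphism `f : T ⟶ S` of connected coverings with point-transitive endomorphisms and a DESCENT DATUM
`a : Aut T →* Aut S` with `σ ≫ f = f ≫ a σ` (abc-iut-L3-t11's `autDescHom`, abc-iut-L3-t9's
`descendBaseAut`, the tower's `step`), and point data `P : T.PtData` pushed to `S` along `f`
(`P.withPts x'`, same reference branches, points `x'_w = f x_w`): `a` carries the base-point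
embeddings, the branch automorphisms `t_b` and the branch elements `s_b` of `T` to those of `S`
(`desc_ptHom`, `desc_brAut`, `desc_brElt`), hence the point presentation of `T` onto that of `S`
(`map_desc_H/M`), and the comparison morphisms `cosetGraph ⊥ ⟶ orbitGraph` of
`CovObjOrbitCosetGraph.lean` commute with `𝔾(f) = orbitGraphMap f` (`toOrbitGraph_push`).  This is the
hetero form of `TemperedPiTreeCosetIso.toOrbitGraph_stepCover`, used for the FINITE levels
`𝒢_{∞,n} → 𝒢_{S n}` of the arithmetic tower.  Nothing here bears on [IUTchIII] Cor. 3.12.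
-/

namespace Literature.AnabelianGeometry.SemiGraphs

namespace ProfiniteSemiGraph

open CategoryTheory
open Literature.AlgebraicGeometry.Frobenioids.QuasiTemperoid.BTempConnected (ρ_one_apply
  ρ_mul_apply ρ_inv_apply ρ_apply_inv)

universe u

variable {𝒢 : ProfiniteSemiGraph.{u}} {T S : CovObj 𝒢} (f : T ⟶ S)
  (hconnT : ∀ p q : T.Point, T.SameComponent p q)
  (htransT : ∀ (v : 𝒢.graph.Vertex) (x x' : (T.SV v).obj.V), ∃ σ : T ⟶ T, (σ.fV v).hom.hom x = x')
  (hconnS : ∀ p q : S.Point, S.SameComponent p q)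
  (htransS : ∀ (v : 𝒢.graph.Vertex) (x x' : (S.SV v).obj.V), ∃ σ : S ⟶ S, (σ.fV v).hom.hom x = x')
  (a : Aut T →* Aut S) (ha : ∀ σ : Aut T, σ.hom ≫ f = f ≫ (a σ).hom)
  (P : T.PtData) (x' : ∀ w : 𝒢.graph.Vertex, (S.SV w).obj.V)
  (hx : ∀ w, (f.fV w).hom.hom (P.x w) = x' w)

/-! ### Point data with the same reference branches -/

/-- Point data on `S` with the SAME reference branches as `P` and base points `x'`.
[cite: MochizukiSemiAnbd2006, Def. 2.2(i) p.23] -/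
def CovObj.PtData.withPts (P : T.PtData) (x' : ∀ w : 𝒢.graph.Vertex, (S.SV w).obj.V) : S.PtData where
  x := x'
  β := P.β
  edgeOf_β := P.edgeOf_β
  ν := P.ν
  abuts_β := P.abuts_β

/-- The base points of `P.withPts x'`. [cite: MochizukiSemiAnbd2006, Def. 2.2(i) p.23] -/
theorem CovObj.PtData.withPts_x (w : 𝒢.graph.Vertex) : (P.withPts x').x w = x' w := rfl

/-! ### Pointwise descent squares -/

include ha in
/-- The descent square on vertex fibres: `f (σ y) = (a σ) (f y)`. [cite: MochizukiSemiAnbd2006, Prop 3.6 p.38] -/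
theorem CovObj.fV_desc_apply (σ : Aut T) {v : 𝒢.graph.Vertex} (y : (T.SV v).obj.V) :
    (f.fV v).hom.hom ((σ.hom.fV v).hom.hom y) = ((a σ).hom.fV v).hom.hom ((f.fV v).hom.hom y) :=
  congrArg (fun ξ : T ⟶ S => (ξ.fV v).hom.hom y) (ha σ)

include ha in
/-- The descent square on edge fibres: `f (σ z) = (a σ) (f z)`. [cite: MochizukiSemiAnbd2006, Prop 3.6 p.38] -/
theorem CovObj.fE_desc_apply (σ : Aut T) {e : 𝒢.graph.Edge} (z : (T.SE e).obj.V) :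
    (f.fE e).hom.hom ((σ.hom.fE e).hom.hom z) = ((a σ).hom.fE e).hom.hom ((f.fE e).hom.hom z) :=
  congrArg (fun ξ : T ⟶ S => (ξ.fE e).hom.hom z) (ha σ)

/-! ### The reference points are carried to each other -/

include hx

/-- `f` carries the edge reference points of `P` to those of `P.withPts x'`.
[cite: MochizukiSemiAnbd2006, Def 3.5(i) p.37] -/
theorem CovObj.PtData.fE_ePt_withPts (e : 𝒢.graph.Edge) :
    (f.fE (𝒢.graph.edgeOf (P.β e))).hom.hom (P.ePt e) = (P.withPts x').ePt e := by
  change (f.fE (𝒢.graph.edgeOf (P.β e))).hom.hom ((T.glue (P.β e) (P.ν e) (P.abuts_β e)).inv.hom.hom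
      (P.x (P.ν e))) = (S.glue (P.β e) (P.ν e) (P.abuts_β e)).inv.hom.hom (x' (P.ν e))
  rw [CovHom.fE_glue_inv', hx]

/-- `f` carries the pushed reference points of `P` to those of `P.withPts x'`.
[cite: MochizukiSemiAnbd2006, Def 3.5(i) p.37] -/
theorem CovObj.PtData.fV_brPt_withPts (b : 𝒢.graph.Branch) (w : 𝒢.graph.Vertex)
    (hw : 𝒢.graph.abuts b = some w) :
    (f.fV w).hom.hom (P.brPt b w hw) = (P.withPts x').brPt b w hw := by
  unfold CovObj.PtData.brPt
  rw [CovHom.fV_glueV']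
  dsimp only
  rw [P.fE_ePt_withPts f x' hx]
  rfl

include ha

/-- **`a` carries the base-point embeddings of `T` to those of `S`**: `a ∘ ψ_{x_w} = ψ_{f x_w}`.
[cite: MochizukiSemiAnbd2006, Rmk. 2.2.1 p.24] -/
theorem CovObj.PtData.desc_ptHom (w : 𝒢.graph.Vertex) (h : 𝒢.Gv w) :
    a (T.ptHom hconnT htransT (P.x w) h) = S.ptHom hconnS htransS ((P.withPts x').x w) h := by
  refine S.aut_eq_of_fV_eq hconnS ((P.withPts x').x w) ?_
  change ((a _).hom.fV w).hom.hom (x' w) = ((S.ptHom hconnS htransS (x' w) h).hom.fV w).hom.hom (x' w)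
  rw [← hx w, ← CovObj.fV_desc_apply f a ha, T.ptHom_apply, CovHom.fV_ρ, S.ptHom_apply]

/-- **`a` carries the branch automorphisms `t_b` of `T` to those of `S`.** [cite: MochizukiSemiAnbd2006, Rmk. 2.2.1 p.24] -/
theorem CovObj.PtData.desc_brAut (b : 𝒢.graph.Branch) (w : 𝒢.graph.Vertex)
    (hw : 𝒢.graph.abuts b = some w) :
    a (P.brAut hconnT htransT b w hw) = (P.withPts x').brAut hconnS htransS b w hw := by
  refine S.aut_eq_of_fV_eq hconnS ((P.withPts x').x w) ?_
  rw [(P.withPts x').brAut_apply hconnS htransS b w hw]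
  change ((a _).hom.fV w).hom.hom (x' w) = _
  rw [← hx w, ← CovObj.fV_desc_apply f a ha, P.brAut_apply hconnT htransT, P.fV_brPt_withPts f x' hx]

/-- **`a` carries the branch elements `s_b` of `T` to those of `S`.** [cite: MochizukiSemiAnbd2006, Rmk. 2.2.1 p.24] -/
theorem CovObj.PtData.desc_brElt (b : 𝒢.graph.Branch) :
    a (P.brElt hconnT htransT b) = (P.withPts x').brElt hconnS htransS b := by
  rcases hb : 𝒢.graph.abuts b with _ | w
  · have h1 : P.brElt hconnT htransT b = 1 := by
      unfold CovObj.PtData.brElt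
      split
      · rename_i w' hw'
        exact absurd (hb.symm.trans hw') (by simp)
      · rfl
    have h2 : (P.withPts x').brElt hconnS htransS b = 1 := by
      unfold CovObj.PtData.brElt
      split
      · rename_i w' hw'
        exact absurd (hb.symm.trans hw') (by simp)
      · rfl
    rw [h1, h2, map_one]
  · rw [P.brElt_of_abuts hconnT htransT b w hb, (P.withPts x').brElt_of_abuts hconnS htransS b w hb,
      map_inv, P.desc_brAut f hconnT htransT hconnS htransS a ha x' hx b w hb]

/-! ### The point presentations are carried to each other -/

/-- `a` maps the vertex subgroups of the point presentation of `T` onto those of `S`.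
[cite: MochizukiSemiAnbd2006, Rmk. 2.2.1 p.24] -/
theorem CovObj.PtData.map_desc_H (w : 𝒢.graph.Vertex) :
    ((P.ptPresentation hconnT htransT).H w).map a = ((P.withPts x').ptPresentation hconnS htransS).H w := by
  change (MonoidHom.range _).map _ = MonoidHom.range _
  rw [MonoidHom.map_range]
  exact congrArg MonoidHom.range
    (MonoidHom.ext fun h => P.desc_ptHom f hconnT htransT hconnS htransS a ha x' hx w h)

/-- `a` maps the edge subgroups of the point presentation of `T` onto those of `S`.
[cite: MochizukiSemiAnbd2006, Rmk. 2.2.1 p.24] -/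
theorem CovObj.PtData.map_desc_M (e : 𝒢.graph.Edge) :
    ((P.ptPresentation hconnT htransT).M e).map a = ((P.withPts x').ptPresentation hconnS htransS).M e := by
  change (Subgroup.map _ _).map _ = Subgroup.map _ _
  rw [Subgroup.map_map]
  exact congrArg (fun φ => Subgroup.map φ _)
    (MonoidHom.ext fun h => P.desc_ptHom f hconnT htransT hconnS htransS a ha x' hx (P.ν e) h)

/-- **The morphism of coset semi-graphs `(P.ptPresentation).cosetGraph ⊥ ⟶ (P').cosetGraph ⊥` along the
descent datum `a`** (`y ↦ a y` on representatives). [cite: MochizukiSemiAnbd2006, Thm 3.7(iii) p.41] -/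
noncomputable def CovObj.PtData.pushHom :
    (P.ptPresentation hconnT htransT).cosetGraph ⊥ ⟶ ((P.withPts x').ptPresentation hconnS htransS).cosetGraph ⊥ :=
  SemiGraph.SubgroupPresentation.cosetGraphMapTo _ _ a ⊥ ⊥
    (P.map_desc_H f hconnT htransT hconnS htransS a ha x' hx)
    (P.map_desc_M f hconnT htransT hconnS htransS a ha x' hx)
    (P.desc_brElt f hconnT htransT hconnS htransS a ha x' hx) (Subgroup.map_bot a)

/-- `pushHom` on vertex representatives. [cite: MochizukiSemiAnbd2006, Thm 3.7(iii) p.41] -/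
theorem CovObj.PtData.pushHom_vertexMap_vMk (w : 𝒢.graph.Vertex) (y : Aut T) :
    (P.pushHom f hconnT htransT hconnS htransS a ha x' hx).vertexMap
        ((P.ptPresentation hconnT htransT).vMk ⊥ w y) =
      ((P.withPts x').ptPresentation hconnS htransS).vMk ⊥ w (a y) := rfl

/-- `pushHom` on edge representatives. [cite: MochizukiSemiAnbd2006, Thm 3.7(iii) p.41] -/
theorem CovObj.PtData.pushHom_edgeMap_eMk (e : 𝒢.graph.Edge) (y : Aut T) :
    (P.pushHom f hconnT htransT hconnS htransS a ha x' hx).edgeMap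
        ((P.ptPresentation hconnT htransT).eMk ⊥ e y) =
      ((P.withPts x').ptPresentation hconnS htransS).eMk ⊥ e (a y) := rfl

/-- `pushHom` on branch representatives. [cite: MochizukiSemiAnbd2006, Thm 3.7(iii) p.41] -/
theorem CovObj.PtData.pushHom_branchMap_bMk (b : 𝒢.graph.Branch) (y : Aut T) :
    (P.pushHom f hconnT htransT hconnS htransS a ha x' hx).branchMap
        ((P.ptPresentation hconnT htransT).bMk ⊥ b y) =
      ((P.withPts x').ptPresentation hconnS htransS).bMk ⊥ b (a y) := rfl

/-- `pushHom` lies over `𝔾`. [cite: MochizukiSemiAnbd2006, Thm 3.7(iii) p.41] -/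
theorem CovObj.PtData.pushHom_comp_proj :
    P.pushHom f hconnT htransT hconnS htransS a ha x' hx ≫
        ((P.withPts x').ptPresentation hconnS htransS).cosetGraphProj ⊥ =
      (P.ptPresentation hconnT htransT).cosetGraphProj ⊥ :=
  SemiGraph.SubgroupPresentation.cosetGraphMapTo_comp_proj _ _ _ _ _ _ _ _ _

/-- `pushHom` intertwines the deck actions: `deckAct ⊥ σ ↦ deckAct ⊥ (a σ)`.
[cite: MochizukiSemiAnbd2006, Thm 3.7(iii) p.41] -/
theorem CovObj.PtData.deckAct_comp_pushHom (σ : Aut T) :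
    ((P.ptPresentation hconnT htransT).deckAct ⊥ σ).hom ≫ P.pushHom f hconnT htransT hconnS htransS a ha x' hx =
      P.pushHom f hconnT htransT hconnS htransS a ha x' hx ≫
        (((P.withPts x').ptPresentation hconnS htransS).deckAct ⊥ (a σ)).hom :=
  SemiGraph.SubgroupPresentation.deckAct_comp_cosetGraphMapTo _ _ _ _ _ _ _ _ _ σ

/-- **The comparison morphisms `cosetGraph ⊥ ⟶ orbitGraph` commute with `𝔾(f)`**:
`toOrbitGraph_T ≫ orbitGraphMap f = pushHom ≫ toOrbitGraph_S`. [cite: MochizukiSemiAnbd2006, Thm 3.7(iii) p.41] -/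
theorem CovObj.PtData.toOrbitGraph_push :
    P.toOrbitGraph hconnT htransT ≫ CovObj.orbitGraphMap f =
      P.pushHom f hconnT htransT hconnS htransS a ha x' hx ≫ (P.withPts x').toOrbitGraph hconnS htransS := by
  refine (P.ptPresentation hconnT htransT).hom_ext_mk ⊥ _ _ (fun w y => ?_) (fun e y => ?_) (fun b y => ?_)
  · change CovObj.OVertex.map f (Quot.mk _ ⟨w, ((y⁻¹).hom.fV w).hom.hom (P.x w)⟩) =
      Quot.mk _ ⟨w, (((a y)⁻¹).hom.fV w).hom.hom (x' w)⟩
    rw [CovObj.oVertexMap_mk, CovObj.fV_desc_apply f a ha, hx, ← map_inv]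
  · change CovObj.OEdge.map f
        (Quot.mk _ ⟨𝒢.graph.edgeOf (P.β e), ((y⁻¹).hom.fE _).hom.hom (P.ePt e)⟩) =
      Quot.mk _ ⟨𝒢.graph.edgeOf (P.β e), (((a y)⁻¹).hom.fE _).hom.hom ((P.withPts x').ePt e)⟩
    change (Quot.mk S.ERel ⟨𝒢.graph.edgeOf (P.β e), (f.fE _).hom.hom
      (((y⁻¹).hom.fE _).hom.hom (P.ePt e))⟩ : S.OEdge) = _
    rw [CovObj.fE_desc_apply f a ha, P.fE_ePt_withPts f x' hx, ← map_inv]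
  · refine Subtype.ext (Prod.ext rfl ?_)
    change CovObj.OEdge.map f
        (Quot.mk _ ⟨𝒢.graph.edgeOf (P.β (𝒢.graph.edgeOf b)),
          ((y⁻¹).hom.fE _).hom.hom (P.ePt (𝒢.graph.edgeOf b))⟩) =
      Quot.mk _ ⟨𝒢.graph.edgeOf (P.β (𝒢.graph.edgeOf b)),
        (((a y)⁻¹).hom.fE _).hom.hom ((P.withPts x').ePt (𝒢.graph.edgeOf b))⟩
    change (Quot.mk S.ERel ⟨𝒢.graph.edgeOf (P.β (𝒢.graph.edgeOf b)), (f.fE _).hom.hom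
      (((y⁻¹).hom.fE _).hom.hom (P.ePt (𝒢.graph.edgeOf b)))⟩ : S.OEdge) = _
    rw [CovObj.fE_desc_apply f a ha, P.fE_ePt_withPts f x' hx, ← map_inv]

/-- Consequently the comparison ISOMORPHISMS commute with `𝔾(f)`.
[cite: MochizukiSemiAnbd2006, Thm 3.7(iii) p.41] -/
theorem CovObj.PtData.cosetGraphIsoOrbitGraph_push :
    (P.cosetGraphIsoOrbitGraph hconnT htransT).hom ≫ CovObj.orbitGraphMap f =
      P.pushHom f hconnT htransT hconnS htransS a ha x' hx ≫
        ((P.withPts x').cosetGraphIsoOrbitGraph hconnS htransS).hom := by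
  rw [CovObj.PtData.cosetGraphIsoOrbitGraph_hom, CovObj.PtData.cosetGraphIsoOrbitGraph_hom]
  exact P.toOrbitGraph_push f hconnT htransT hconnS htransS a ha x' hx

end ProfiniteSemiGraph

end Literature.AnabelianGeometry.SemiGraphs
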